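import Mathlib.Geometry.Manifold.SmoothEmbedding
import Mathlib.Geometry.Manifold.Instances.Real
import Mathlib.Geometry.Manifold.IsManifold.InteriorBoundary
import Mathlib.Data.ENat.Lattice
import Literature.Topology.FourManifolds.Handles
import Literature.Topology.FourManifolds.SmoothOrientation
import HarnessLib

/-!
# Trisections of smooth 4-manifolds (Gay–Kirby)

Topic `Literature/Topology/FourManifolds` (definition item `defn-Trisection`, route
`SmoothPoincare4/GroupTrisection`).

A **`(g; k₁, k₂, k₃)`-trisection** of a closed connected oriented smooth 4-manifold `X` is a
decomposition `X = X₁ ∪ X₂ ∪ X₃` into three compact codimension-`0` submanifolds with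

* `Xᵢ ≅ Z_{kᵢ} = ♮^{kᵢ}(S¹ × B³)` (a 4-dimensional 1-handlebody of genus `kᵢ`),
* `Hᵢⱼ = Xᵢ ∩ Xⱼ ≅ ♮^g(S¹ × D²)` a 3-dimensional genus-`g` handlebody for `i ≠ j`,
* `F = X₁ ∩ X₂ ∩ X₃ = ∂Hᵢⱼ` a closed orientable surface of genus `g`

(Gay–Kirby 2016, Def. 1, in the balanced case `k₁ = k₂ = k₃ = k`; unbalanced version
Meier–Schirmer–Zupan 2016, §2). Following the request, no Morse 2-function is used; the pieces are
presented in the relational style of `ConnectedSum.lean` / `Gluing.lean` and their diffeomorphism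
types are pinned down through the library's handle vocabulary (`Literature.Topology.FourManifolds.HasHandleDecomposition`,
`Handles.lean`):

* `handleCount a b : ℕ → ℕ` — `a` handles of index `0`, `b` of index `1`, none higher;
* `IsTrisection X g k S` for `S : Fin 3 → Set X` (the sectors) — (i) the sectors cover `X`;
  (ii) each `S i` is the image of a smooth embedding `e : W ↪ X` (`W` modelled on `ℝ³ × [0,∞)`) of
  a compact connected `W` admitting a handle decomposition with one `0`-handle and `k i`
  `1`-handles, and the other sectors meet `S i` only along `e(∂W)`; (iii) for `i ≠ j`,
  `S i ∩ S j` is the image of a smooth embedding `h : H ↪ X` of a compact connected 3-manifold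
  with boundary admitting one `0`-handle and `g` `1`-handles, and `h(∂H) = S 0 ∩ S 1 ∩ S 2`.
  For oriented `X` this is equivalent to GK/MSZ: an orientable 1-handlebody with the said handles
  is `♮^k(S¹ × B³)` resp. `♮^g(S¹ × D²)`; invariance of domain gives `e(∂W) = S j ∪ S l` on the
  frontier, so `∂Xᵢ = Hᵢⱼ ∪_F Hᵢₗ` is a genus-`g` Heegaard splitting of `#^{kᵢ}(S¹ × S²)`, which
  is standard by Waldhausen's theorem — precisely GK's condition (2) (their remark after Def. 1).
* `IsBalancedTrisection X g k S := IsTrisection X g (fun _ => k) S` (GK's `(g, k)`-trisections);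
* `trisectionGenus X : ℕ∞` — the least genus of a trisection (`⊤` if none; finite for closed
  connected oriented `X` by GK Thm 4);
* API: covering/projection lemmas, invariance under permuting the three sectors
  (`IsTrisection.comp_perm`), `trisectionGenus_le`.
* Named fact (statement, D-0014): `exists_isBalancedGKTrisection` — GK 2016 Thm 4 (existence of a
  `(g, k)`-trisection with `k ≤ g` for every closed connected oriented smooth 4-manifold), over
  the corrected predicate `IsBalancedGKTrisection`.
  **Warning (misstatement of the first vendoring).** `IsTrisection` is unsatisfiable — clause (ii)
  forbids the corners that GK's sectors have along the central surface
  (`TrisectionsRefutation.lean`, `Literature.Topology.FourManifolds.TrisectionRefutation.not_isTrisection`) —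
  so every statement over `IsTrisection`/`IsBalancedTrisection`/`trisectionGenus` is vacuous, and
  the first vendoring of GK Thm 4 over it, `exists_isBalancedTrisection`, is false as stated
  (`Literature.Topology.FourManifolds.TrisectionRefutation.not_exists_isBalancedTrisection`).
  **Verdict clean-up 2026-08-15** (prove-seat verdict: mis-stated, refuted in tree; re-verified
  against arXiv:1205.1565 p. 3, Def. 1 and Thm. 4, and against the tree): that def is now an
  `@[deprecated exists_isBalancedGKTrisection]` RECORD at the very end of this file, its statement
  kept verbatim only because its refutation (`TrisectionsRefutation.lean`) and the thesis file
  `Summits/SmoothPoincare4/SmoothPoincare4/Theses/GroupTrisection.lean` (`Assembly`, `Assembly2`,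
  hypothesis `h₁`) name it; nothing may use it as a hypothesis.  The old *predicates* are kept
  unchanged (not deprecated) while their importers (`TrisectionEuler`, `TrisectionFunctor`,
  `SmallTrisections`, the `GroupTrisection` thesis) are migrated.  The corrected predicate
  `IsGKTrisection` (sectors = topologically embedded `1`-handlebodies `W`, `C^∞` immersed off the
  central surface `F` and given at the points of `F` by a *corner chart* `IsCornerAt`: in smooth
  charts `e = A ∘ cornerUnbend`, i.e. the sector is the linear image `A(Q)` of the model quadrant
  `cornerQuadrant` and `W` is the sector with its angle straightened by the principal square root
  `cornerUnbend = (cornerFold|_Q)⁻¹`), the argument that it is equivalent to GK's Def. 1 read with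
  corners (so that existence *and* classification statements keep their printed strength over
  it), its non-vacuity (GK's genus-`0` trisection of `S⁴`, §2, walked through clause (ii) in the
  docstring of `IsGKTrisection`; the local model is proved in `isCornerAt_model`), its API and the
  corrected fact `exists_isBalancedGKTrisection` are in the last part of this file.
  Uniqueness up to stabilisation (GK Thm 11) and trisection *diagrams* (GK Def. 3: Heegaard
  diagrams on `F_g`) need curve systems on surfaces and are not vendored here.

## Design choices

* Sectors are closed subsets `S i ⊆ X`; the abstract pieces `W`, `H` (universe `u` of `X`) enter
  existentially with their smooth embeddings, exactly as gluing data do elsewhere in the topic.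
  No `IsManifold`/orientation hypotheses inside the predicate; `X` closed connected oriented is
  the context of the facts (as in GK).
* Genus of the central surface is not a separate clause: `F = h(∂H)` is the boundary of a
  genus-`g` handlebody.
* `trisectionGenus` is `ℕ∞`-valued (`⨅`), no junk `sInf ∅ = 0`.
* Mathlib: smooth embeddings, immersions (`Manifold.IsImmersionAt`, charts in maximal atlases),
  `𝓡∂ n`, `ModelWithCorners.boundary`; handle decompositions are the library's Morse-theoretic
  `HasHandleDecomposition`.  Mathlib has models with corners (`EuclideanQuadrant`) but no
  angle-straightening, so the corner of a sector along `F` is recorded by the explicit corner chart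
  `IsCornerAt` (polynomial folding map `cornerFold`; its inverse on the quadrant, the principal
  square root `cornerUnbend`, is only needed for the API and the model `isCornerAt_model`).  No
  trisections/Heegaard splittings in Mathlib or the tree (searched `trisection`, `Heegaard`).

## References

* D. Gay, R. Kirby, *Trisecting 4-manifolds*, Geom. Topol. 20 (2016) 3097–3132
  (arXiv:1205.1565): Def. 1, Remark 2, Thm 4, Def. 8, Thm 11.
* J. Meier, T. Schirmer, A. Zupan, *Classification of trisections and the generalized property R
  conjecture*, Proc. AMS 144 (2016) 4983–4997, §2 (unbalanced trisections).
* F. Waldhausen, *Heegaard-Zerlegungen der 3-Sphäre*, Topology 7 (1968); F. Laudenbach,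
  V. Poénaru, *A note on 4-dimensional handlebodies*, Bull. SMF 100 (1972).
* J. Milnor, *Lectures on the h-cobordism theorem*, Princeton (1965), Thm. 3.4 (a cobordism with a
  Morse function without critical points is a product) — used in the comparison of straightenings.
* A. Douady, *Variétés à bord anguleux et voisinages tubulaires*, Séminaire H. Cartan 14
  (1961/62), exp. 1: §1 (secteurs), §4 (variétés à bord anguleux) — manifolds with corners.
* A. Douady, L. Hérault, *Arrondissement des variétés à coins*, appendix to A. Borel, J.-P. Serre,
  *Corners and arithmetic groups*, Comment. Math. Helv. 48 (1973) 436–491 — straightening the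
  angle is well defined up to diffeomorphism.
-/

open scoped Manifold ContDiff Topology
open Set Function

noncomputable section

namespace Literature.Topology.FourManifolds

universe u

/-- Handle counts of a *1-handlebody*: `a` handles of index `0`, `b` handles of index `1`, none
of higher index (argument for `Literature.Topology.FourManifolds.HasHandleDecomposition`). [cite: GayKirby2016, Def. 1] -/
def handleCount (a b : ℕ) : ℕ → ℕ := fun i => if i = 0 then a else if i = 1 then b else 0

/-- `handleCount a b` has `a` handles of index `0`. [cite: GayKirby2016, Def. 1] -/
@[simp] theorem handleCount_zero (a b : ℕ) : handleCount a b 0 = a := rfl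

/-- `handleCount a b` has `b` handles of index `1`. [cite: GayKirby2016, Def. 1] -/
@[simp] theorem handleCount_one (a b : ℕ) : handleCount a b 1 = b := rfl

/-- `handleCount a b` has no handles of index `≥ 2`. [cite: GayKirby2016, Def. 1] -/
theorem handleCount_of_two_le (a b : ℕ) {i : ℕ} (hi : 2 ≤ i) : handleCount a b i = 0 := by
  unfold handleCount
  rw [if_neg (by omega), if_neg (by omega)]

section Trisection

variable (X : Type u) [TopologicalSpace X] [ChartedSpace (EuclideanSpace ℝ (Fin 4)) X]

/-- **Trisection** (Gay–Kirby, unbalanced form of Meier–Schirmer–Zupan). `IsTrisection X g k S`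
says that the three closed sectors `S 0, S 1, S 2 ⊆ X` form a `(g; k 0, k 1, k 2)`-trisection of
the smooth 4-manifold `X`:
(i) `S 0 ∪ S 1 ∪ S 2 = X`;
(ii) each sector `S i` is the image of a smooth embedding `e : W ↪ X` of a compact connected
4-manifold with boundary `W` having a handle decomposition with one `0`-handle and `k i`
`1`-handles (`W ≅ ♮^{k i}(S¹ × B³)` for oriented `X`), the other sectors meeting `S i` only in
`e(∂W)`;
(iii) for `i ≠ j` the double intersection `S i ∩ S j` is the image of a smooth embedding
`h : H ↪ X` of a compact connected 3-manifold with boundary `H` having one `0`-handle and `g`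
`1`-handles (a genus-`g` handlebody `♮^g(S¹ × D²)`), whose boundary surface `h(∂H)` (closed,
genus `g`) is the triple intersection `S 0 ∩ S 1 ∩ S 2`.
**Warning.** This first transcription of GK's Def. 1 is *unsatisfiable*
(`Literature.Topology.FourManifolds.TrisectionRefutation.not_isTrisection`): clause (ii) forbids
the corners that GK's sectors have along the central surface.  Use `IsGKTrisection` (below); this
predicate is kept unchanged only while its importers are migrated.
[cite: GayKirby2016, Def. 1] -/
def IsTrisection (g : ℕ) (k : Fin 3 → ℕ) (S : Fin 3 → Set X) : Prop :=
  (⋃ i, S i) = univ ∧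
  (∀ i, ∃ (W : Type u) (_ : TopologicalSpace W) (_ : ChartedSpace (EuclideanHalfSpace 4) W)
      (e : W → X), CompactSpace W ∧ ConnectedSpace W ∧
        HasHandleDecomposition 3 W (handleCount 1 (k i)) ∧
        Manifold.IsSmoothEmbedding (𝓡∂ 4) (𝓡 4) ∞ e ∧ range e = S i ∧
        ∀ j, j ≠ i → S i ∩ S j ⊆ e '' (𝓡∂ 4).boundary W) ∧
  (∀ i j, i ≠ j → ∃ (H : Type u) (_ : TopologicalSpace H) (_ : ChartedSpace (EuclideanHalfSpace 3) H)
      (h : H → X), CompactSpace H ∧ ConnectedSpace H ∧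
        HasHandleDecomposition 2 H (handleCount 1 g) ∧
        Manifold.IsSmoothEmbedding (𝓡∂ 3) (𝓡 4) ∞ h ∧ range h = S i ∩ S j ∧
        h '' (𝓡∂ 3).boundary H = ⋂ l, S l)

/-- A **balanced** `(g, k)`-trisection: all three sectors are `♮^k(S¹ × B³)` (Gay–Kirby's original
Def. 1).  **Warning.** Unsatisfiable like `IsTrisection`
(`Literature.Topology.FourManifolds.TrisectionRefutation.not_isBalancedTrisection`); use
`IsBalancedGKTrisection`. [cite: GayKirby2016, Def. 1] -/
def IsBalancedTrisection (g k : ℕ) (S : Fin 3 → Set X) : Prop :=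
  IsTrisection X g (fun _ => k) S

/-- The **trisection genus** of `X` over `IsTrisection`: the least `g` such that `X` admits a
`(g; k₁, k₂, k₃)`-trisection, in `ℕ∞` (`⊤` if `X` has none).  **Warning.** Since `IsTrisection`
is unsatisfiable this is always `⊤`
(`Literature.Topology.FourManifolds.TrisectionRefutation.trisectionGenus_eq_top`); the
non-vacuous version is `gkTrisectionGenus`. [cite: GayKirby2016, Remark 2] -/
def trisectionGenus : ℕ∞ :=
  ⨅ (g : ℕ) (k : Fin 3 → ℕ) (S : Fin 3 → Set X) (_ : IsTrisection X g k S), (g : ℕ∞)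

variable {X}
variable {g : ℕ} {k : Fin 3 → ℕ} {S : Fin 3 → Set X}

/-- The sectors of a trisection cover `X`. [cite: GayKirby2016, Def. 1] -/
theorem IsTrisection.iUnion_eq (h : IsTrisection X g k S) : (⋃ i, S i) = univ := h.1

/-- Every point of `X` lies in some sector. [cite: GayKirby2016, Def. 1] -/
theorem IsTrisection.exists_mem (h : IsTrisection X g k S) (x : X) : ∃ i, x ∈ S i := by
  have hx : x ∈ ⋃ i, S i := h.1 ▸ mem_univ x
  simpa using hx

/-- Each sector is the image of a compact space under a continuous map, hence compact.
[cite: GayKirby2016, Def. 1] -/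
theorem IsTrisection.isCompact (h : IsTrisection X g k S) (i : Fin 3) : IsCompact (S i) := by
  obtain ⟨W, _, _, e, hW, -, -, he, hrange, -⟩ := h.2.1 i
  rw [← hrange]
  exact isCompact_range he.isEmbedding.continuous

/-- A trisected manifold is compact (finite union of compact sectors). [cite: GayKirby2016, Def. 1] -/
theorem IsTrisection.compactSpace (h : IsTrisection X g k S) : CompactSpace X := by
  refine ⟨?_⟩
  rw [← h.iUnion_eq]
  exact isCompact_iUnion fun i => h.isCompact i

/-- A balanced trisection is a trisection (definitional). [cite: GayKirby2016, Def. 1] -/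
theorem IsBalancedTrisection.isTrisection {g k : ℕ} {S : Fin 3 → Set X}
    (h : IsBalancedTrisection X g k S) : IsTrisection X g (fun _ => k) S :=
  h

/-- The trisection genus is at most the genus of any trisection. [cite: GayKirby2016, Remark 2] -/
theorem trisectionGenus_le (h : IsTrisection X g k S) : trisectionGenus X ≤ g :=
  (iInf_le _ g).trans <| (iInf_le _ k).trans <| (iInf_le _ S).trans <| iInf_le _ h

/-- **Symmetry.** Relabelling the three sectors by a permutation of `{0, 1, 2}` (and the `kᵢ`
accordingly) preserves being a trisection. [cite: GayKirby2016, Def. 1] -/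
theorem IsTrisection.comp_perm (h : IsTrisection X g k S) (σ : Equiv.Perm (Fin 3)) :
    IsTrisection X g (k ∘ σ) (S ∘ σ) := by
  obtain ⟨hcov, hsec, hpair⟩ := h
  have hI : (⋂ l, S (σ l)) = ⋂ l, S l :=
    le_antisymm (le_iInf fun l => by simpa using iInf_le (fun l => S (σ l)) (σ.symm l))
      (le_iInf fun l => iInf_le S (σ l))
  refine ⟨?_, fun i => ?_, fun i j hij => ?_⟩
  · rw [← univ_subset_iff, ← hcov]
    exact iUnion_subset fun i => by
      simpa using subset_iUnion (fun l => S (σ l)) (σ.symm i)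
  · obtain ⟨W, _, _, e, hW, hc, hh, he, hrange, hbdry⟩ := hsec (σ i)
    refine ⟨W, _, _, e, hW, hc, hh, he, hrange, fun j hj => hbdry (σ j) ?_⟩
    exact fun heq => hj (σ.injective heq)
  · obtain ⟨H, _, _, f, hH, hc, hh, hf, hrange, hbdry⟩ :=
      hpair (σ i) (σ j) fun heq => hij (σ.injective heq)
    exact ⟨H, _, _, f, hH, hc, hh, hf, hrange, hbdry.trans hI.symm⟩

end Trisection

/-! ### Corrected predicate: sectors with corners along the central surface

`IsTrisection` above is **unsatisfiable** (`Literature.Topology.FourManifolds.TrisectionRefutation.not_isTrisection` in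
`TrisectionsRefutation.lean`): clause (ii) makes every sector the image of a smooth embedding of a
manifold *with boundary*, i.e. to first order a closed half-space at each of its points, and three
closed half-spaces of `ℝ⁴` cannot have pairwise disjoint interiors — yet the three sectors meet at
every point of the central surface `F = S 0 ∩ S 1 ∩ S 2 ≠ ∅`.  Consequently the first vendoring
of GK Thm 4 over it, `exists_isBalancedTrisection` (now the `@[deprecated]` record at the end of
this file), is false as stated
(`Literature.Topology.FourManifolds.TrisectionRefutation.not_exists_isBalancedTrisection`).

**What GK's Definition 1 says** (arXiv p. 2): "a `(g, k)`-trisection of a closed, connected,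
oriented `4`-manifold `X` is a decomposition of `X` into three submanifolds `X = X₁ ∪ X₂ ∪ X₃`
satisfying: (1) for each `i` there is a diffeomorphism `φᵢ : Xᵢ → Z_k` (`= ♮^k(S¹ × B³)`);
(2) `φᵢ(Xᵢ ∩ X_{i+1}) = Y⁻_{k,g}` and `φᵢ(Xᵢ ∩ X_{i-1}) = Y⁺_{k,g}`" (the two handlebodies of the
standard genus-`g` Heegaard splitting of `∂Z_k = #^k(S¹ × S²)`; Fig. 1: three sectors of a disc).
Since the `Xᵢ` meet pairwise in `3`-manifolds and all three along the surface `F`, each `Xᵢ ⊆ X`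
is a compact codimension-`0` submanifold **with corners** of index `2` along `F` (Douady's "bord
anguleux"; locally the model quadrant `Q × ℝ² ⊆ ℝ⁴`), its two faces being `H_{ij} = Xᵢ ∩ Xⱼ` and
`H_{il}`, and — as always in handlebody theory — "`φᵢ : Xᵢ → Z_k` diffeomorphism" refers to `Xᵢ`
with the angle along `F` *straightened* (Douady–Hérault: in a product neighbourhood `F × Q₂` of
the corner stratum open the right angle of the quadrant `Q₂ ⊆ ℝ²` to a straight angle by
`(r, θ) ↦ (r, 2θ)`; the resulting smooth manifold with boundary is well defined up to
diffeomorphism), equivalently to a diffeomorphism of manifolds with corners onto `Z_k` bent along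
the Heegaard surface.  Read with `Xᵢ` smooth submanifolds with boundary the definition would have
no instance at all, by the argument above.

**The predicate `IsGKTrisection`** below repairs clause (ii) accordingly and changes nothing
else: the sector `S i` is the image of a *topological* embedding `e : W → X` of a compact
connected smooth `4`-manifold with boundary `W` (a `1`-handlebody with `k i` `1`-handles, i.e.
`W ≅ Z_{k i}` when orientable) which is

* a `C^∞` immersion (Mathlib's `Manifold.IsImmersionAt`: linear in charts of the maximal
  atlases) at every point *not* mapped to `F` — so off `F` the sector is a smooth codimension-`0`
  submanifold with boundary and `e` a diffeomorphism onto it —, and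
* at every point `w` mapped to `F`, given in suitable charts `φ` of `W` (maximal `C^∞` atlas of
  the half-space model, `φ w = 0`) and `ψ` of `X` (maximal `C^∞` atlas) by
  `ψ ∘ e ∘ φ⁻¹ = A ∘ cornerUnbend` for a linear automorphism `A` of `ℝ⁴` (`IsCornerAt`,
  `IsCornerAt.exists_eqOn`), where `cornerFold (y₀, y₁, y₂, y₃) = (2 y₀ y₁, y₁² - y₀², y₂, y₃)`
  folds the model quadrant `Q = {y₀ ≥ 0, y₁ ≥ 0}` homeomorphically onto the half-space
  `{x₀ ≥ 0}` (complex squaring `y₁ + i y₀ ↦ (y₁ + i y₀)²` in the plane normal to the corner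
  stratum `{y₀ = y₁ = 0}`, a diffeomorphism off that stratum) and `cornerUnbend = (cornerFold|_Q)⁻¹`
  is the principal square root.

Thus near a point of `F` the sector `S i` is, in a smooth chart of `X`, *exactly* the linear
`2`-sector `A(Q)` (a genuine convex corner of the normal plane, as in GK's Fig. 1), its two faces
being the ends of `H_{ij}` and `H_{il}` at `F`, and `W` is `S i` with the angle along `F`
straightened by the principal square root; the local model `e = A ∘ cornerUnbend` on the
half-space is *proved* to satisfy the clause (`isCornerAt_model`).  Clause (iii) is unchanged
(each `H_{ij}` is a smoothly embedded `3`-dimensional handlebody with boundary `F`); we only add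
the previously missing `IsManifold` requirements on the abstract pieces `W`, `H`.

**`IsGKTrisection` versus GK's Definition 1.**  For a closed connected oriented smooth `X` the two
notions agree.  Neither implication is a quotable theorem, so we record the (folklore) arguments;
they use only collars/tubular neighbourhoods and Milnor's product theorem for cobordisms carrying
a function without critical points (Milnor 1965, Thm. 3.4).

*GK ⇒ `IsGKTrisection`.*  Let `X = X₁ ∪ X₂ ∪ X₃` be a trisection as just described, `Xᵢ` with
corners along `F`.  (a) *Linearising the faces.*  The faces `H_{ij}`, `H_{il}` of `Xᵢ` are compact
smooth `3`-submanifolds with common boundary `F` whose inward normals at a point of `F` span a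
convex sector of the normal plane (`Xᵢ` is locally `Q × ℝ²` in a chart).  In a tubular
neighbourhood `U ≅ F × ℝ²` of `F` (after a fibrewise linear normalisation and a reparametrisation
of the collars) each face is a graph `{(f, s·v + s²c(f, s)·v^⊥) | s ≥ 0}` over its tangent ray
`ℝ₊v`; a first shear `(f, x·v₁ + t·v₁^⊥) ↦ (f, x·v₁ + (t + x²c₁(f, x))·v₁^⊥)` straightens one
face, and then `(f, x·v₁ + t·v₂) ↦ (f, x·v₁ + t·v₂ + t²c₂(f, t)·v₂^⊥)` — again a diffeomorphism
near `F` (differential the identity along `F`), and the identity on the ray `ℝ₊v₁` — straightens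
the second face while keeping the first; so there is a tubular neighbourhood `Θ : U ≅ F × ℝ²`
with `Θ(Xᵢ ∩ U) = F × Σ`, `Σ ⊆ ℝ²` a closed convex linear sector (alternatively: compatible
collars of the two faces, Douady–Hérault).
(b) *The atlas.*  Put `W := Xᵢ` with the charts: charts of `X` at interior points (translated
into `{x₀ > 0}`), half-space charts of the submanifold-with-boundary `Xᵢ ∖ F ⊆ X ∖ F` at points of
`H ∖ F`, and at points of `F` the *corner charts* `cornerFold ∘ A⁻¹ ∘ (χ × id) ∘ Θ` (`χ` charts of
`F`, `A` one fixed linear map with `A(Q) = Σ × ℝ²` up to the order of coordinates).  A transition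
map between two corner charts is `cornerFold ∘ (id × χ'χ⁻¹) ∘ cornerUnbend = id × χ'χ⁻¹`; all
other transition maps live off the corner stratum, where `cornerUnbend` is a local
diffeomorphism; so this is a `C^∞` atlas for `𝓡∂ 4` (`IsManifold`).  Then `e := Subtype.val` is a
topological embedding onto `Xᵢ`, a `C^∞` immersion off `F` (complement the zero space, charts
`ψ|_{Xᵢ}` and `ψ`), and has the corner charts at `F` by construction (this is `isCornerAt_model`
transported by `(χ × id) ∘ Θ`).  (c) *`W ≅ Z_k`.*  `W` is `Xᵢ` straightened, except that the angle
is opened by `(r, θ) ↦ (r², 2θ)` (complex squaring) instead of `(r, θ) ↦ (r, 2θ)`; the two smooth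
structures differ near `F` by the radial homeomorphism `r ↦ r²` of the normal disc, and
interpolating it to the identity along the radius gives a diffeomorphism between them.  Hence
`W ≅ Z_k`, which carries a Morse function adapted to the boundary with one critical point of index
`0` and `k` of index `1`, i.e. `HasHandleDecomposition 3 W (handleCount 1 k)`; `W` is compact and
connected, and `Xᵢ ∩ Xⱼ = H_{ij} ⊆ e(∂W)`.  Clause (iii) holds with `h` the inclusion of the
handlebody `H_{ij} = φᵢ⁻¹(Y⁻)` (a smooth compact `3`-submanifold with boundary `F`).

*`IsGKTrisection` ⇒ GK.*  Given clause (ii), `S i` is a compact codimension-`0` submanifold with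
corners of `X`: off `F` by the immersion charts, at `F` because it is `A(Q)` in the corner charts;
its faces are `e(∂W) = H_{ij} ∪ H_{il}` (invariance of domain) with corner stratum `F`, and by
(iii) the faces are smooth `3`-manifolds with boundary `F`.  Let `W'` (with `e' : W' → S i`) be
the straightening of `S i` built as in (a)–(b) from a linearising tubular neighbourhood.  Then
`η := e'⁻¹ ∘ e : W → W'` is a homeomorphism of compact smooth `4`-manifolds with boundary which
is a diffeomorphism off `K := e⁻¹(F) ⊆ ∂W`, and in corner charts of `W` and `W'` at a point of `K`
it reads `(sq × id) ∘ σ ∘ (sq⁻¹ × id)` with `sq` = complex squaring and `σ = ψ' ∘ ψ⁻¹` a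
diffeomorphism between open subsets of `ℝ⁴` preserving `Q × ℝ²` and its two faces, so that
`σ(y₀, y₁, y') = (y₀·α, y₁·β, σ_s)` with `α, β > 0` smooth (Hadamard).  Consequently, for
boundary-defining functions `t` of `W` and `t'` of `W'` (collar coordinates), the ratio
`ρ := (t' ∘ η)/t` extends continuously and positively over `∂W`, and `t·|dρ| = O(d(·, K)^{1/2})`
near `K` (`sq⁻¹` has derivative `O(r^{-1/2})` while `t = O(r)`).  Replacing `t` by `ρ̃·t` for a
smooth positive approximation `ρ̃` of `ρ` and interpolating, `λ(t)·t + (1 - λ(t))·(t' ∘ η)` (`λ` a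
cut-off equal to `1` near `0`) is a smooth function on a collar region `C ⊆ W` of `∂W` without
critical points, equal to `t` near `∂W` and to `t' ∘ η` near the inner boundary of `C`; by
Milnor's product theorem `C` is a product, with the product structure chosen to agree with
`η^* (collar lines of W')` near the inner boundary, and `η` restricted to the complement of the
collar extends along these lines to a diffeomorphism `W ≅ W'`.  Hence the straightened sector is
`W' ≅ W`, an orientable (it immerses into the oriented `X`) `1`-handlebody with one `0`-handle and
`k i` `1`-handles, i.e. `♮^{k i}(S¹ × B³) = Z_{k i}` — GK's (1).  GK's (2) then follows from
(ii)–(iii): `∂W = H ∪_F H'` is a genus-`g` Heegaard splitting of `#^k(S¹ × S²)`, which is standard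
(Waldhausen), and every diffeomorphism of `#^k(S¹ × S²)` extends over `Z_k` (Laudenbach–Poénaru),
so `φᵢ` can be chosen with `φᵢ(H_{ij}) = Y⁻`, `φᵢ(H_{il}) = Y⁺`.

*Consequences.*  Existence statements (GK Thm. 4: `exists_isBalancedGKTrisection` below) and
uniqueness/classification statements (GK Thm. 11 and Cor. 12, Meier–Schirmer–Zupan, Meier–Zupan)
keep their printed strength when phrased over `IsGKTrisection`/`IsBalancedGKTrisection`; the
importers of the old predicate (`TrisectionEuler`, `TrisectionFunctor`, `SmallTrisections`, the
`GroupTrisection` thesis) should be migrated to it.  The old predicates are kept unchanged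
meanwhile; the existence fact is `exists_isBalancedGKTrisection` (the first vendoring
`exists_isBalancedTrisection` survives only as the `@[deprecated]` record at the end of the file).
Non-vacuity: GK's genus-`0` trisection of `S⁴` is walked through clause (ii) in the docstring of
`IsGKTrisection`. -/

section CornerModel

/-- The closed **model quadrant** `Q = {y | 0 ≤ y 0 ∧ 0 ≤ y 1} ⊆ ℝ⁴`: Douady's adapted sector of
index `2` (`x_{i₁} ≥ 0, x_{i₂} ≥ 0`), the local model of a `4`-manifold with corners of
codimension `2` along the corner stratum `{y 0 = y 1 = 0} ≅ ℝ²`. [cite: Douady1961, §1 and §4] -/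
def cornerQuadrant : Set (EuclideanSpace ℝ (Fin 4)) :=
  {y | 0 ≤ y 0 ∧ 0 ≤ y 1}

/-- The **corner-folding map** `ℝ⁴ → ℝ⁴`, `(y₀, y₁, y₂, y₃) ↦ (2 y₀ y₁, y₁² - y₀², y₂, y₃)`:
complex squaring `y₁ + i y₀ ↦ (y₁ + i y₀)²` in the first two coordinates, the identity in the last
two.  It is polynomial, restricts to a homeomorphism from the quadrant `cornerQuadrant` onto the
closed half-space `{x | 0 ≤ x 0}` (the model of `EuclideanHalfSpace 4`) which is a diffeomorphism
off the corner stratum `{y 0 = y 1 = 0}` and the identity on it; its inverse `cornerUnbend`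
(principal square root, opening the straight angle of the half-space to a right angle) is the
homeomorphism straightening the angle of a manifold with corners of index `2` ("arrondissement
des variétés à coins", up to the radial reparametrisation `r ↦ r²`).
[cite: DouadyHerault1973, Appendice] -/
def cornerFold (y : EuclideanSpace ℝ (Fin 4)) : EuclideanSpace ℝ (Fin 4) :=
  !₂[2 * y 0 * y 1, y 1 ^ 2 - y 0 ^ 2, y 2, y 3]

/-- First coordinate of `cornerFold`: `2 y₀ y₁` (imaginary part of `(y₁ + i y₀)²`).
[cite: DouadyHerault1973, Appendice] -/
@[simp] theorem cornerFold_apply_zero (y : EuclideanSpace ℝ (Fin 4)) :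
    cornerFold y 0 = 2 * y 0 * y 1 := rfl

/-- Second coordinate of `cornerFold`: `y₁² - y₀²` (real part of `(y₁ + i y₀)²`).
[cite: DouadyHerault1973, Appendice] -/
@[simp] theorem cornerFold_apply_one (y : EuclideanSpace ℝ (Fin 4)) :
    cornerFold y 1 = y 1 ^ 2 - y 0 ^ 2 := rfl

/-- `cornerFold` is the identity in the third coordinate (along the corner stratum).
[cite: DouadyHerault1973, Appendice] -/
@[simp] theorem cornerFold_apply_two (y : EuclideanSpace ℝ (Fin 4)) : cornerFold y 2 = y 2 := rfl

/-- `cornerFold` is the identity in the fourth coordinate (along the corner stratum).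
[cite: DouadyHerault1973, Appendice] -/
@[simp] theorem cornerFold_apply_three (y : EuclideanSpace ℝ (Fin 4)) : cornerFold y 3 = y 3 :=
  rfl

/-- `cornerFold` is smooth (polynomial). [cite: DouadyHerault1973, Appendice] -/
theorem contDiff_cornerFold : ContDiff ℝ ∞ cornerFold := by
  have hc : ∀ i : Fin 4, ContDiff ℝ ∞ fun y : EuclideanSpace ℝ (Fin 4) => y i :=
    fun i => contDiff_euclidean.mp contDiff_id i
  rw [contDiff_euclidean]
  intro i
  fin_cases i
  · exact (contDiff_const.mul (hc 0)).mul (hc 1)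
  · exact ((hc 1).pow 2).sub ((hc 0).pow 2)
  · exact hc 2
  · exact hc 3

/-- `cornerFold` maps the model quadrant into the closed half-space `{x | 0 ≤ x 0}`.
[cite: DouadyHerault1973, Appendice] -/
theorem cornerFold_apply_zero_nonneg {y : EuclideanSpace ℝ (Fin 4)} (hy : y ∈ cornerQuadrant) :
    0 ≤ cornerFold y 0 := by
  rw [cornerFold_apply_zero]
  exact mul_nonneg (mul_nonneg zero_le_two hy.1) hy.2

/-- `cornerFold` fixes the corner stratum `{y 0 = y 1 = 0}` pointwise.
[cite: DouadyHerault1973, Appendice] -/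
theorem cornerFold_eq_self {y : EuclideanSpace ℝ (Fin 4)} (h0 : y 0 = 0) (h1 : y 1 = 0) :
    cornerFold y = y := by
  ext i
  fin_cases i
  · simp [h0]
  · simp [h0, h1]
  · simp
  · simp

/-- `cornerFold` is injective on the model quadrant (complex squaring is injective on the closed
first quadrant), so that its inverse "straightening the angle" is well defined there.
[cite: DouadyHerault1973, Appendice] -/
theorem cornerFold_injOn : InjOn cornerFold cornerQuadrant := by
  intro y hy y' hy' h
  have h0 : 2 * y 0 * y 1 = 2 * y' 0 * y' 1 := by simpa using congrArg (· 0) h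
  have h1 : y 1 ^ 2 - y 0 ^ 2 = y' 1 ^ 2 - y' 0 ^ 2 := by simpa using congrArg (· 1) h
  have h2 : y 2 = y' 2 := by simpa using congrArg (· 2) h
  have h3 : y 3 = y' 3 := by simpa using congrArg (· 3) h
  obtain ⟨ha, hb⟩ := hy
  obtain ⟨hc, hd⟩ := hy'
  have hsq : (y 0 ^ 2 + y 1 ^ 2) ^ 2 = (y' 0 ^ 2 + y' 1 ^ 2) ^ 2 := by
    calc (y 0 ^ 2 + y 1 ^ 2) ^ 2 = (y 1 ^ 2 - y 0 ^ 2) ^ 2 + (2 * y 0 * y 1) ^ 2 := by ring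
      _ = (y' 1 ^ 2 - y' 0 ^ 2) ^ 2 + (2 * y' 0 * y' 1) ^ 2 := by rw [h0, h1]
      _ = (y' 0 ^ 2 + y' 1 ^ 2) ^ 2 := by ring
  have hsum : y 0 ^ 2 + y 1 ^ 2 = y' 0 ^ 2 + y' 1 ^ 2 :=
    (pow_left_inj₀ (by positivity) (by positivity) two_ne_zero).mp hsq
  have e0 : y 0 = y' 0 := (pow_left_inj₀ ha hc two_ne_zero).mp (by linarith)
  have e1 : y 1 = y' 1 := (pow_left_inj₀ hb hd two_ne_zero).mp (by linarith)
  ext i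
  fin_cases i
  · exact e0
  · exact e1
  · exact h2
  · exact h3

/-- On the model quadrant, `cornerFold y = 0` only for `y = 0` (the corner point goes to the
origin and nothing else does). [cite: DouadyHerault1973, Appendice] -/
theorem cornerFold_eq_zero_iff {y : EuclideanSpace ℝ (Fin 4)} (hy : y ∈ cornerQuadrant) :
    cornerFold y = 0 ↔ y = 0 := by
  have h0 : (0 : EuclideanSpace ℝ (Fin 4)) ∈ cornerQuadrant := ⟨le_rfl, le_rfl⟩
  have hf0 : cornerFold 0 = 0 := cornerFold_eq_self rfl rfl
  refine ⟨fun h => cornerFold_injOn hy h0 (h.trans hf0.symm), fun h => h ▸ hf0⟩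

/-- The **angle-straightening map** `ℝ⁴ → ℝ⁴` ("principal square root"),
`(x₀, x₁, x₂, x₃) ↦ (√((r - x₁)/2), √((r + x₁)/2), x₂, x₃)` with `r = √(x₀² + x₁²)`: in the
first two coordinates the principal branch `y₁ + i y₀ = √(x₁ + i x₀)` of the complex square root
on the closed upper half-plane `{x₀ ≥ 0}`, the identity in the last two.  It takes values in the
model quadrant `cornerQuadrant` and inverts `cornerFold` on the closed half-space `{x | 0 ≤ x 0}`
(`cornerFold_cornerUnbend`, `cornerUnbend_cornerFold`): the homeomorphism from the half-space
model onto the quadrant model that opens the straight angle to a right angle, a diffeomorphism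
off the corner stratum. [cite: DouadyHerault1973, Appendice] -/
def cornerUnbend (x : EuclideanSpace ℝ (Fin 4)) : EuclideanSpace ℝ (Fin 4) :=
  !₂[√((√(x 0 ^ 2 + x 1 ^ 2) - x 1) / 2), √((√(x 0 ^ 2 + x 1 ^ 2) + x 1) / 2), x 2, x 3]

/-- First coordinate of `cornerUnbend` (imaginary part of the principal square root).
[cite: DouadyHerault1973, Appendice] -/
@[simp] theorem cornerUnbend_apply_zero (x : EuclideanSpace ℝ (Fin 4)) :
    cornerUnbend x 0 = √((√(x 0 ^ 2 + x 1 ^ 2) - x 1) / 2) := rfl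

/-- Second coordinate of `cornerUnbend` (real part of the principal square root).
[cite: DouadyHerault1973, Appendice] -/
@[simp] theorem cornerUnbend_apply_one (x : EuclideanSpace ℝ (Fin 4)) :
    cornerUnbend x 1 = √((√(x 0 ^ 2 + x 1 ^ 2) + x 1) / 2) := rfl

/-- `cornerUnbend` is the identity in the third coordinate. [cite: DouadyHerault1973, Appendice] -/
@[simp] theorem cornerUnbend_apply_two (x : EuclideanSpace ℝ (Fin 4)) : cornerUnbend x 2 = x 2 :=
  rfl

/-- `cornerUnbend` is the identity in the fourth coordinate. [cite: DouadyHerault1973, Appendice] -/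
@[simp] theorem cornerUnbend_apply_three (x : EuclideanSpace ℝ (Fin 4)) :
    cornerUnbend x 3 = x 3 :=
  rfl

/-- `cornerUnbend` takes values in the model quadrant. [cite: DouadyHerault1973, Appendice] -/
theorem cornerUnbend_mem_cornerQuadrant (x : EuclideanSpace ℝ (Fin 4)) :
    cornerUnbend x ∈ cornerQuadrant :=
  ⟨Real.sqrt_nonneg _, Real.sqrt_nonneg _⟩

/-- `cornerFold ∘ cornerUnbend = id` on the closed half-space `{x | 0 ≤ x 0}` (squaring the
principal square root). [cite: DouadyHerault1973, Appendice] -/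
theorem cornerFold_cornerUnbend {x : EuclideanSpace ℝ (Fin 4)} (hx : 0 ≤ x 0) :
    cornerFold (cornerUnbend x) = x := by
  set r := √(x 0 ^ 2 + x 1 ^ 2) with hr
  have hrsq : r ^ 2 = x 0 ^ 2 + x 1 ^ 2 := Real.sq_sqrt (by positivity)
  have hr1 : |x 1| ≤ r := by
    rw [← Real.sqrt_sq_eq_abs]
    exact Real.sqrt_le_sqrt (by nlinarith [sq_nonneg (x 0)])
  have ha : 0 ≤ (r - x 1) / 2 := by linarith [le_abs_self (x 1)]
  have hb : 0 ≤ (r + x 1) / 2 := by linarith [neg_abs_le (x 1)]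
  have hab : (r - x 1) / 2 * ((r + x 1) / 2) = (x 0 / 2) ^ 2 := by
    rw [show (r - x 1) / 2 * ((r + x 1) / 2) = (r ^ 2 - x 1 ^ 2) / 4 by ring, hrsq]
    ring
  ext i
  fin_cases i
  · show cornerFold (cornerUnbend x) 0 = x 0
    rw [cornerFold_apply_zero, cornerUnbend_apply_zero, cornerUnbend_apply_one, mul_assoc,
      ← Real.sqrt_mul ha, hab, Real.sqrt_sq (by linarith)]
    ring
  · show cornerFold (cornerUnbend x) 1 = x 1
    rw [cornerFold_apply_one, cornerUnbend_apply_zero, cornerUnbend_apply_one, Real.sq_sqrt hb,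
      Real.sq_sqrt ha]
    ring
  · rfl
  · rfl

/-- `cornerUnbend ∘ cornerFold = id` on the model quadrant (the principal square root of the
square). [cite: DouadyHerault1973, Appendice] -/
theorem cornerUnbend_cornerFold {y : EuclideanSpace ℝ (Fin 4)} (hy : y ∈ cornerQuadrant) :
    cornerUnbend (cornerFold y) = y :=
  cornerFold_injOn (cornerUnbend_mem_cornerQuadrant _) hy
    (cornerFold_cornerUnbend (cornerFold_apply_zero_nonneg hy))

/-- On the model quadrant, `cornerFold` takes the value `x` (with `0 ≤ x 0`) exactly at
`cornerUnbend x`. [cite: DouadyHerault1973, Appendice] -/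
theorem cornerFold_eq_iff_eq_cornerUnbend {y x : EuclideanSpace ℝ (Fin 4)}
    (hy : y ∈ cornerQuadrant) (hx : 0 ≤ x 0) : cornerFold y = x ↔ y = cornerUnbend x :=
  ⟨fun h => by rw [← h, cornerUnbend_cornerFold hy], fun h => by rw [h, cornerFold_cornerUnbend hx]⟩

end CornerModel

section GKTrisection

variable {X : Type u} [TopologicalSpace X] [ChartedSpace (EuclideanSpace ℝ (Fin 4)) X]

/-- **Corner chart** of a map `e : W → X` from a `4`-manifold with boundary to a `4`-manifold at
`w ∈ W`: there are a chart `φ` of `W` in the maximal `C^∞` atlas of the half-space model with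
`φ w = 0`, a chart `ψ` of `X` in the maximal `C^∞` atlas with `e(φ.source) ⊆ ψ.source`, and a
linear automorphism `A` of `ℝ⁴`, such that on `φ`'s domain `A⁻¹ ∘ ψ ∘ e ∘ φ⁻¹` takes values in the
model quadrant `Q` and is inverted by `cornerFold` — i.e. `ψ ∘ e ∘ φ⁻¹ = A ∘ cornerUnbend`
(`IsCornerAt.exists_eqOn`) is the angle-straightening homeomorphism (principal square root)
followed by `A`.  Then, near `e w`, the image of `e` is in the chart `ψ` the linear `2`-sector
`A(Q)` (a manifold with corners of index `2` at `e w`, Douady) and `W` is that sector with its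
angle straightened (Douady–Hérault); off `φ⁻¹(corner stratum)` such an `e` is a `C^∞` immersion.
This is the local model of a sector of a trisection at a point of the central surface; the model
itself satisfies the predicate (`isCornerAt_model`).  The condition is phrased like Mathlib's
`Manifold.ImmersionAtProp` (charts in maximal atlases, equation on `(φ.extend I).target`).
[cite: Douady1961, §1 and §4] -/
def IsCornerAt {W : Type*} [TopologicalSpace W] [ChartedSpace (EuclideanHalfSpace 4) W]
    (e : W → X) (w : W) : Prop :=
  ∃ (φ : OpenPartialHomeomorph W (EuclideanHalfSpace 4))
    (ψ : OpenPartialHomeomorph X (EuclideanSpace ℝ (Fin 4)))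
    (A : EuclideanSpace ℝ (Fin 4) ≃L[ℝ] EuclideanSpace ℝ (Fin 4)),
    φ ∈ IsManifold.maximalAtlas (𝓡∂ 4) ∞ W ∧ ψ ∈ IsManifold.maximalAtlas (𝓡 4) ∞ X ∧
    w ∈ φ.source ∧ φ.source ⊆ e ⁻¹' ψ.source ∧ (φ w).val = 0 ∧
    ∀ x ∈ (φ.extend (𝓡∂ 4)).target,
      A.symm (ψ (e ((φ.extend (𝓡∂ 4)).symm x))) ∈ cornerQuadrant ∧
      cornerFold (A.symm (ψ (e ((φ.extend (𝓡∂ 4)).symm x)))) = x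

/-- In a corner chart, the corner point `w` (with `φ w = 0`) is mapped by `ψ ∘ e` to the origin:
`A⁻¹ (ψ (e w))` lies in the quadrant and folds to `φ w = 0`. [cite: Douady1961, §1 and §4] -/
theorem IsCornerAt.exists_chart_apply_eq_zero {W : Type*} [TopologicalSpace W]
    [ChartedSpace (EuclideanHalfSpace 4) W] {e : W → X} {w : W} (h : IsCornerAt e w) :
    ∃ ψ : OpenPartialHomeomorph X (EuclideanSpace ℝ (Fin 4)),
      ψ ∈ IsManifold.maximalAtlas (𝓡 4) ∞ X ∧ e w ∈ ψ.source ∧ ψ (e w) = 0 := by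
  obtain ⟨φ, ψ, A, -, hψ, hw, hsrc, hw0, hloc⟩ := h
  refine ⟨ψ, hψ, hsrc hw, ?_⟩
  have hwt : (φ.extend (𝓡∂ 4)) w ∈ (φ.extend (𝓡∂ 4)).target :=
    (φ.extend (𝓡∂ 4)).map_source (by rwa [OpenPartialHomeomorph.extend_source])
  obtain ⟨hQ, hfold⟩ := hloc _ hwt
  rw [(φ.extend (𝓡∂ 4)).left_inv (by rwa [OpenPartialHomeomorph.extend_source])] at hQ hfold
  have hzero : (φ.extend (𝓡∂ 4)) w = 0 := by
    rw [OpenPartialHomeomorph.extend_coe, Function.comp_apply]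
    exact hw0
  rw [hzero, cornerFold_eq_zero_iff hQ] at hfold
  simpa using congrArg A hfold

/-- In a corner chart `(φ, ψ, A)` of `e` at `w` one has literally
`ψ ∘ e ∘ φ⁻¹ = A ∘ cornerUnbend` on the chart target: the image of `e` is the linear `2`-sector
`A(Q)` and `e` is the angle-straightening homeomorphism followed by `A`.
[cite: Douady1961, §1 and §4] -/
theorem IsCornerAt.exists_eqOn {W : Type*} [TopologicalSpace W]
    [ChartedSpace (EuclideanHalfSpace 4) W] {e : W → X} {w : W} (h : IsCornerAt e w) :
    ∃ (φ : OpenPartialHomeomorph W (EuclideanHalfSpace 4))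
      (ψ : OpenPartialHomeomorph X (EuclideanSpace ℝ (Fin 4)))
      (A : EuclideanSpace ℝ (Fin 4) ≃L[ℝ] EuclideanSpace ℝ (Fin 4)),
      φ ∈ IsManifold.maximalAtlas (𝓡∂ 4) ∞ W ∧ ψ ∈ IsManifold.maximalAtlas (𝓡 4) ∞ X ∧
      w ∈ φ.source ∧ φ.source ⊆ e ⁻¹' ψ.source ∧ (φ w).val = 0 ∧
      EqOn (ψ ∘ e ∘ (φ.extend (𝓡∂ 4)).symm) (A ∘ cornerUnbend) (φ.extend (𝓡∂ 4)).target := by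
  obtain ⟨φ, ψ, A, hφ, hψ, hw, hsrc, hw0, hloc⟩ := h
  refine ⟨φ, ψ, A, hφ, hψ, hw, hsrc, hw0, fun x hx => ?_⟩
  obtain ⟨hQ, hfold⟩ := hloc x hx
  have hx0 : 0 ≤ x 0 := by
    have hxr : x ∈ range (𝓡∂ 4) := φ.extend_target_subset_range hx
    simpa [range_modelWithCornersEuclideanHalfSpace] using hxr
  have hy := (cornerFold_eq_iff_eq_cornerUnbend hQ hx0).mp hfold
  simpa using congrArg A hy

/-- **Non-vacuity of the corner chart: the linear sector.**  For every linear automorphism `A`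
of `ℝ⁴`, the map `e = A ∘ cornerUnbend ∘ Subtype.val` from the half-space model
`EuclideanHalfSpace 4 = {x | 0 ≤ x 0}` to `ℝ⁴`, whose image is the linear `2`-sector `A(Q)`, has
a corner chart at the origin (`φ`, `ψ` the identity charts of the two model spaces).  This is the
local model to which clause (ii) of `IsGKTrisection` reduces near a point of the central surface.
[cite: Douady1961, §1 and §4] -/
theorem isCornerAt_model (A : EuclideanSpace ℝ (Fin 4) ≃L[ℝ] EuclideanSpace ℝ (Fin 4)) :
    IsCornerAt (X := EuclideanSpace ℝ (Fin 4))
      (fun w : EuclideanHalfSpace 4 => A (cornerUnbend w.val))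
      (⟨0, le_rfl⟩ : EuclideanHalfSpace 4) := by
  refine ⟨OpenPartialHomeomorph.refl _, OpenPartialHomeomorph.refl _, A,
    StructureGroupoid.id_mem_maximalAtlas _, StructureGroupoid.id_mem_maximalAtlas _, mem_univ _,
    fun _ _ => mem_univ _, rfl, fun x hx => ?_⟩
  have hxr : x ∈ range (𝓡∂ 4) :=
    (OpenPartialHomeomorph.refl (EuclideanHalfSpace 4)).extend_target_subset_range hx
  have hx0 : 0 ≤ x 0 := by simpa [range_modelWithCornersEuclideanHalfSpace] using hxr
  have hval : (((OpenPartialHomeomorph.refl (EuclideanHalfSpace 4)).extend (𝓡∂ 4)).symm x).val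
      = x := by
    have h1 : ((OpenPartialHomeomorph.refl (EuclideanHalfSpace 4)).extend (𝓡∂ 4)).symm x =
        (𝓡∂ 4).symm x := by
      simp [OpenPartialHomeomorph.extend]
    rw [h1]
    exact (𝓡∂ 4).right_inv hxr
  simp only [OpenPartialHomeomorph.refl_apply, id_eq, ContinuousLinearEquiv.symm_apply_apply]
  rw [hval]
  exact ⟨cornerUnbend_mem_cornerQuadrant x, cornerFold_cornerUnbend hx0⟩

variable (X)

/-- **Trisection (Gay–Kirby, Def. 1), sectors with corners along the central surface.**
`IsGKTrisection X g k S` says that the closed sectors `S 0, S 1, S 2 ⊆ X` form a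
`(g; k 0, k 1, k 2)`-trisection of the smooth `4`-manifold `X` (balanced case `k 0 = k 1 = k 2` is
GK's Def. 1; the unbalanced form is Meier–Schirmer–Zupan's):
(i) `S 0 ∪ S 1 ∪ S 2 = X`;
(ii) each sector `S i` is the image of a topological embedding `e : W → X` of a compact connected
smooth `4`-manifold with boundary `W` having a handle decomposition with one `0`-handle and `k i`
`1`-handles (`W ≅ Z_{k i} = ♮^{k i}(S¹ × B³)`), which is a `C^∞` immersion at every point not
mapped to the central surface `F = S 0 ∩ S 1 ∩ S 2` and has a corner chart (`IsCornerAt`: in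
charts `e = A ∘ cornerUnbend`, so `S i` is a linear `2`-sector near each point of `F` and `W` is
`S i` with the angle along `F` straightened) at every point mapped to `F`; the other sectors meet
`S i` only in `e(∂W)`;
(iii) for `i ≠ j` the double intersection `S i ∩ S j` is the image of a smooth embedding
`h : H → X` of a compact connected smooth `3`-manifold with boundary having one `0`-handle and `g`
`1`-handles (a genus-`g` handlebody `H_g = ♮^g(S¹ × D²)`), with `h(∂H) = F` (so `F` is a closed
surface of genus `g`).
For closed connected oriented `X` this is equivalent to GK's Def. 1 read with corners along `F`
(both implications are argued in the section docstring above: linearising the two faces of a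
sector near `F` for "GK ⇒", comparison of two straightenings via boundary-defining functions and
Milnor's product theorem for "⇒ GK (1)", Waldhausen + Laudenbach–Poénaru for "⇒ GK (2)").
**Non-vacuity** (GK §2, first example, arXiv p. 6): `S⁴ ⊂ ℂ × ℝ³` (unit sphere),
`X_j = {(r e^{iθ}, x) | 2πj/3 ≤ θ ≤ 2π(j+1)/3}` (`j = 0, 1, 2`) is a genus-`0` trisection:
`g = k = 0`, `F = {z = 0} = S²`, `H_{j,j+1} = {θ = 2π(j+1)/3}` a closed hemisphere of a great
`3`-sphere.  Clause (ii) for `S j := X_j` (as a subtype, universe of `X`): near `F` use the charts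
`Ψ(z, x) = (z, ς(x/|x|)) ∈ ℂ × ℝ²` of `S⁴` (`ς` a stereographic chart of `S²` centred at the point
considered; `Ψ⁻¹(z, p) = (z, √(1 - |z|²)·ς⁻¹ p)`), in which `X_j = Σ_j × ℝ² = A_j(Q)` for
`Σ_j ⊂ ℂ` the closed sector of angle `2π/3` and `A_j` the linear automorphism sending `e₁, e₀`
to the unit vectors of argument `2πj/3, 2π(j+1)/3` and fixing `e₂, e₃`.  Take `W := ↥X_j` with
the atlas of (b) in the section docstring: sphere charts translated into `{x₀ > 0}` at points with
`θ` inside the sector, `Ψ` followed by a rotation of `ℂ` (making `X_j` the side `{x₀ ≥ 0}`) at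
points of the open rays, and the corner charts `cornerFold ∘ A_j⁻¹ ∘ Ψ` at points of `F`;
corner–corner transition maps are `id_ℂ × (ς' ∘ ς⁻¹)` and commute with `cornerFold`, all other
transition maps avoid `F`, so `IsManifold (𝓡∂ 4) ∞ W`.  `e := Subtype.val` is an embedding with
range `X_j`, a `C^∞` immersion off `F` with complement the zero space (`ℝ⁴ × 0 ≃L ℝ⁴`), and
`IsCornerAt e w` for `w ∈ F` is `isCornerAt_model A_j` read through `Ψ`; `X_j ∩ X_l ⊆ e(∂W)`
since the rays and `F` have first corner/half-space coordinate `0`.  `W` is compact, connected,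
and diffeomorphic to `B⁴`: `(z, x) ↦ (q z, μ(z)·x)`, with `q = sq ∘ A_j⁻¹` (`sq` = complex
squaring) near `0` continued to a diffeomorphism `Σ_j ∖ 0 → {Im ≥ 0} ∖ 0` with `|q z| = |z|` for
`|z| ≥ 1/2` and `μ = √(1 - |q z|²)/√(1 - |z|²)`, is in the corner charts the identity, hence a
diffeomorphism of `W` onto the closed hemisphere `{Im z ≥ 0}` of `S⁴`, on which `1 - Im z` is a
Morse function equal to `1` and regular on the boundary, `< 1` inside, with a single critical
point, of index `0`: `HasHandleDecomposition 3 W (handleCount 1 0)`.  Clause (iii): `H_{j,j+1}` is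
the image of the closed unit `3`-ball under the inverse stereographic projection (from the
antipode `(-e^{iθ}, 0)`) of the great `3`-sphere `S⁴ ∩ (ℝe^{iθ} × ℝ³)`, `θ = 2π(j+1)/3`, a smooth
embedding `h` with `h(∂B³) = F = X_0 ∩ X_1 ∩ X_2`, and `B³` has one `0`-handle and no `1`-handle.
Clause (i) is clear. [cite: GayKirby2016, Def. 1] -/
def IsGKTrisection (g : ℕ) (k : Fin 3 → ℕ) (S : Fin 3 → Set X) : Prop :=
  (⋃ i, S i) = univ ∧
  (∀ i, ∃ (W : Type u) (_ : TopologicalSpace W) (_ : ChartedSpace (EuclideanHalfSpace 4) W)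
      (e : W → X), IsManifold (𝓡∂ 4) ∞ W ∧ CompactSpace W ∧ ConnectedSpace W ∧
        HasHandleDecomposition 3 W (handleCount 1 (k i)) ∧
        Topology.IsEmbedding e ∧ range e = S i ∧
        (∀ w, e w ∉ (⋂ l, S l) → Manifold.IsImmersionAt (𝓡∂ 4) (𝓡 4) ∞ e w) ∧
        (∀ w, e w ∈ (⋂ l, S l) → IsCornerAt e w) ∧
        ∀ j, j ≠ i → S i ∩ S j ⊆ e '' (𝓡∂ 4).boundary W) ∧
  (∀ i j, i ≠ j → ∃ (H : Type u) (_ : TopologicalSpace H) (_ : ChartedSpace (EuclideanHalfSpace 3) H)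
      (h : H → X), IsManifold (𝓡∂ 3) ∞ H ∧ CompactSpace H ∧ ConnectedSpace H ∧
        HasHandleDecomposition 2 H (handleCount 1 g) ∧
        Manifold.IsSmoothEmbedding (𝓡∂ 3) (𝓡 4) ∞ h ∧ range h = S i ∩ S j ∧
        h '' (𝓡∂ 3).boundary H = ⋂ l, S l)

/-- A **balanced** `(g, k)`-trisection with corners along the central surface: Gay–Kirby's
Def. 1 (`k₁ = k₂ = k₃ = k`). [cite: GayKirby2016, Def. 1] -/
def IsBalancedGKTrisection (g k : ℕ) (S : Fin 3 → Set X) : Prop :=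
  IsGKTrisection X g (fun _ => k) S

/-- The **trisection genus** of `X` over `IsGKTrisection`: the least `g` such that `X` admits a
`(g; k₁, k₂, k₃)`-trisection, in `ℕ∞` (`⊤` if none; finite for closed connected oriented `X` by
`exists_isBalancedGKTrisection`). [cite: GayKirby2016, Remark 2] -/
def gkTrisectionGenus : ℕ∞ :=
  ⨅ (g : ℕ) (k : Fin 3 → ℕ) (S : Fin 3 → Set X) (_ : IsGKTrisection X g k S), (g : ℕ∞)

variable {X}
variable {g : ℕ} {k : Fin 3 → ℕ} {S : Fin 3 → Set X}

/-- The sectors of a trisection cover `X`. [cite: GayKirby2016, Def. 1] -/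
theorem IsGKTrisection.iUnion_eq (h : IsGKTrisection X g k S) : (⋃ i, S i) = univ := h.1

/-- Every point of `X` lies in some sector. [cite: GayKirby2016, Def. 1] -/
theorem IsGKTrisection.exists_mem (h : IsGKTrisection X g k S) (x : X) : ∃ i, x ∈ S i := by
  have hx : x ∈ ⋃ i, S i := h.1 ▸ mem_univ x
  simpa using hx

/-- Each sector is the image of a compact space under a continuous map, hence compact.
[cite: GayKirby2016, Def. 1] -/
theorem IsGKTrisection.isCompact (h : IsGKTrisection X g k S) (i : Fin 3) : IsCompact (S i) := by
  obtain ⟨W, _, _, e, -, hW, -, -, he, hrange, -⟩ := h.2.1 i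
  rw [← hrange]
  exact isCompact_range he.continuous

/-- A trisected manifold is compact (finite union of compact sectors). [cite: GayKirby2016, Def. 1] -/
theorem IsGKTrisection.compactSpace (h : IsGKTrisection X g k S) : CompactSpace X := by
  refine ⟨?_⟩
  rw [← h.iUnion_eq]
  exact isCompact_iUnion fun i => h.isCompact i

/-- The central surface `F = S 0 ∩ S 1 ∩ S 2` of a trisection is the image of the boundary of the
handlebody `H₀₁`; in particular it is compact. [cite: GayKirby2016, Remark 2] -/
theorem IsGKTrisection.isCompact_iInter (h : IsGKTrisection X g k S) : IsCompact (⋂ l, S l) := by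
  obtain ⟨H, _, _, f, hM, hH, -, -, hf, -, hbdry⟩ := h.2.2 0 1 (by decide)
  haveI := hM
  haveI := hH
  rw [← hbdry]
  exact (ModelWithCorners.isClosed_boundary (I := 𝓡∂ 3) (M := H) (n := ∞) (by simp)).isCompact.image
    hf.isEmbedding.continuous

/-- A balanced trisection is a trisection (definitional). [cite: GayKirby2016, Def. 1] -/
theorem IsBalancedGKTrisection.isGKTrisection {g k : ℕ} {S : Fin 3 → Set X}
    (h : IsBalancedGKTrisection X g k S) : IsGKTrisection X g (fun _ => k) S :=
  h

/-- The trisection genus is at most the genus of any trisection. [cite: GayKirby2016, Remark 2] -/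
theorem gkTrisectionGenus_le (h : IsGKTrisection X g k S) : gkTrisectionGenus X ≤ g :=
  (iInf_le _ g).trans <| (iInf_le _ k).trans <| (iInf_le _ S).trans <| iInf_le _ h

/-- **Symmetry.** Relabelling the three sectors by a permutation of `{0, 1, 2}` (and the `kᵢ`
accordingly) preserves being a trisection. [cite: GayKirby2016, Def. 1] -/
theorem IsGKTrisection.comp_perm (h : IsGKTrisection X g k S) (σ : Equiv.Perm (Fin 3)) :
    IsGKTrisection X g (k ∘ σ) (S ∘ σ) := by
  obtain ⟨hcov, hsec, hpair⟩ := h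
  have hI : (⋂ l, S (σ l)) = ⋂ l, S l :=
    le_antisymm (le_iInf fun l => by simpa using iInf_le (fun l => S (σ l)) (σ.symm l))
      (le_iInf fun l => iInf_le S (σ l))
  refine ⟨?_, fun i => ?_, fun i j hij => ?_⟩
  · rw [← univ_subset_iff, ← hcov]
    exact iUnion_subset fun i => by
      simpa using subset_iUnion (fun l => S (σ l)) (σ.symm i)
  · obtain ⟨W, _, _, e, hM, hW, hc, hh, he, hrange, himm, hcorner, hbdry⟩ := hsec (σ i)
    refine ⟨W, _, _, e, hM, hW, hc, hh, he, hrange, fun w hw => himm w ?_, fun w hw => hcorner w ?_,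
      fun j hj => hbdry (σ j) ?_⟩
    · change e w ∉ ⋂ l, S (σ l) at hw
      rwa [hI] at hw
    · change e w ∈ ⋂ l, S (σ l) at hw
      rwa [hI] at hw
    · exact fun heq => hj (σ.injective heq)
  · obtain ⟨H, _, _, f, hM, hH, hc, hh, hf, hrange, hbdry⟩ :=
      hpair (σ i) (σ j) fun heq => hij (σ.injective heq)
    refine ⟨H, _, _, f, hM, hH, hc, hh, hf, hrange, ?_⟩
    change f '' _ = ⋂ l, S (σ l)
    rw [hI]; exact hbdry

end GKTrisection

/-- **Gay–Kirby 2016, Theorem 4 (existence of trisections) — corrected vendoring.** Every closed,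
connected, oriented smooth `4`-manifold `X` admits a `(g, k)`-trisection for some `0 ≤ k ≤ g`
(`IsBalancedGKTrisection`: sectors with corners along the central surface, as in GK's Def. 1 and
Fig. 1); moreover `X` then has a handle decomposition with one `0`-handle, `k` `1`-handles, `g - k`
`2`-handles, `k` `3`-handles and one `4`-handle (not vendored).  This replaces the first
vendoring `exists_isBalancedTrisection` (the `@[deprecated]` record below), which is stated over
the unsatisfiable `IsTrisection` and is therefore false
(`Literature.Topology.FourManifolds.TrisectionRefutation.not_exists_isBalancedTrisection`).
Orientation is `Literature.Topology.FourManifolds.SmoothOrientation`. [cite: GayKirby2016, Thm 4] -/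
def exists_isBalancedGKTrisection : Prop :=
  ∀ (X : Type u) [TopologicalSpace X] [T2Space X] [SecondCountableTopology X]
    [ChartedSpace (EuclideanSpace ℝ (Fin 4)) X] [IsManifold (𝓡 4) ∞ X] [CompactSpace X]
    [ConnectedSpace X] (_ : SmoothOrientation (𝓡 4) X),
    ∃ (g k : ℕ) (S : Fin 3 → Set X), k ≤ g ∧ IsBalancedGKTrisection X g k S

/-! ### Record: the first vendoring of GK Thm. 4 (mis-stated; refuted in tree)

Verdict clean-up 2026-08-15.  `exists_isBalancedTrisection` below is **not** a live named fact: it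
is Gay–Kirby's Theorem 4 transcribed over the unsatisfiable predicate `IsBalancedTrisection`, hence
false, and it is refuted in tree.  It is kept, verbatim and `@[deprecated]`, only because its
refutation (`Literature.Topology.FourManifolds.TrisectionRefutation.not_exists_isBalancedTrisection`,
`TrisectionsRefutation.lean`, where `linter.deprecated` is silenced on exactly the three theorems
naming it) and the gate-written thesis file of route `SmoothPoincare4/GroupTrisection`
(`Assembly`, `Assembly2`: hypothesis `h₁`, flagged there for restatement over
`exists_isBalancedGKTrisection`) name it.  REMOVE-WHEN no module of the tree names it any more. -/

/-- **Record — MIS-STATED and REFUTED in tree** (prove-seat verdict; verdict clean-up 2026-08-15;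
never use it as a hypothesis).  The first vendoring of **Gay–Kirby 2016, Theorem 4** — "Every
closed, connected, oriented `4`-manifold `X` has a `(g,k)`-trisection for some `0 ≤ k ≤ g`"
(arXiv:1205.1565 p. 3; the handle-decomposition clause was not vendored) — over the predicate
`IsBalancedTrisection X g k S = IsTrisection X g (fun _ => k) S` of this file.
**What is wrong:** not Gay–Kirby's theorem but the transcription of their Definition 1 underneath
it.  `IsTrisection`, clause (ii), makes every sector `S i` the image of a smooth embedding of a
`4`-manifold *with boundary* which meets the other two sectors only along the image of that
boundary; but GK's sectors `X₁, X₂, X₃` (Def. 1: "`φᵢ : Xᵢ → Z_k`" diffeomorphisms with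
"`φᵢ(Xᵢ ∩ X_{i±1}) = Y^∓_{k,g}`", the two handlebodies of a Heegaard splitting of `∂Z_k`; Fig. 1:
three sectors of a disc) meet pairwise in `3`-dimensional handlebodies with common boundary the
central surface `F = X₁ ∩ X₂ ∩ X₃`, so each `Xᵢ ⊆ X` has a corner of index `2` along `F` and is
diffeomorphic to `Z_k` only after straightening the angle.  Read with boundary instead of corners,
the three sectors would be, to first order at a point of `F ≠ ∅`, three closed half-spaces of `ℝ⁴`
with pairwise disjoint interiors, which do not exist: `IsTrisection` is unsatisfiable
(`Literature.Topology.FourManifolds.TrisectionRefutation.not_isTrisection`) and the closed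
statement below is false —
`Literature.Topology.FourManifolds.TrisectionRefutation.not_exists_isBalancedTrisection :
¬ exists_isBalancedTrisection.{0}` (`TrisectionsRefutation.lean`; witnessed by the round `S⁴`,
oriented by `isOrientable_sphere_holds`; axioms `propext`, `Classical.choice`, `Quot.sound`).
**Replacement:** `exists_isBalancedGKTrisection` above — the same theorem, same citation, over
`IsBalancedGKTrisection` (sectors with corners along `F`, `IsCornerAt`), non-vacuous
(`Literature.Topology.FourManifolds.sphere_genusZero_gkTrisection_holds`,
`SphereTrisectionsSectors.lean`: GK's genus-`0` trisection of `S⁴`).  Its consumers exist in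
corrected form as well (`TrisectionEuler.lean`:
`gkTrisection_genus_eq_sum_of_homotopyEquiv_sphere.exists_isBalancedGKTrisection_three_mul`).
The statement below is unchanged and kept only because its refutation and the thesis
`SmoothPoincare4/GroupTrisection` (`Assembly`, `Assembly2`) name it.
[cite: GayKirby2016, Thm 4 — MIS-TRANSCRIBED over the unsatisfiable predicate IsTrisection (sectors need corners along the central surface, Def. 1 and Fig. 1); REFUTED in tree by TrisectionRefutation.not_exists_isBalancedTrisection; corrected as exists_isBalancedGKTrisection] -/
@[deprecated exists_isBalancedGKTrisection "mis-stated (transcribed over the unsatisfiable predicate IsTrisection: Gay–Kirby's sectors have corners along the central surface, arXiv:1205.1565 Def. 1 / Fig. 1) and refuted in tree (Literature.Topology.FourManifolds.TrisectionRefutation.not_exists_isBalancedTrisection): use Literature.Topology.FourManifolds.exists_isBalancedGKTrisection" (since := "2026-08-15")]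
def exists_isBalancedTrisection : Prop :=
  ∀ (X : Type u) [TopologicalSpace X] [T2Space X] [SecondCountableTopology X]
    [ChartedSpace (EuclideanSpace ℝ (Fin 4)) X] [IsManifold (𝓡 4) ∞ X] [CompactSpace X]
    [ConnectedSpace X] (_ : SmoothOrientation (𝓡 4) X),
    ∃ (g k : ℕ) (S : Fin 3 → Set X), k ≤ g ∧ IsBalancedTrisection X g k S

end Literature.Topology.FourManifolds

end
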